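import Mathlib.Analysis.InnerProductSpace.PiL2
import Mathlib.Analysis.Normed.Operator.LinearIsometry
import Literature.Analysis.FluidPDE.AxisymmetricEuler
import HarnessLib

/-!
# Type II core witnesses: rescaled `C⁰`-closeness of a velocity slice to a profile class

Analysis/FluidPDE vocabulary file (two definitions and their proved elementary API; no named
facts) for the blow-up zoom at the core scale, next to `IsTypeIBlowup` (`SuitableWeak`) and the
Koch–Nadirashvili–Seregin–Šverák zoom-in (`KNSSTypeIIZoomIn`). It factors the witness predicate
that route `TypeIIInviscidRelaxation` (Navier–Stokes regularity) inlines in three of its items.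

Fix a viscosity `ν`, a level `K`, a time-dependent velocity field `u : ℝ → E → E` on a real
normed space `E` (physical space `ℝ³ = EuclideanSpace ℝ (Fin 3)` in the application) and a time
`t`. A **level-`K` core witness of class `C`** for the slice `u t`
(`TypeIICoreWitness C ν K u t`) consists of a centre `x₀`, a core length `L > 0`, a speed bound
`V > 0`, a linear isometry `Q : E ≃ₗᵢ[ℝ] E` and a profile `W : E → E` of class `C` (`C W`) with

* `V` bounds the speed everywhere, `‖u t x‖ ≤ V`, and is attained within a factor `2` in the
  closed ball `B̄(x₀, L)` (the near-maximum normalisation of Koch–Nadirashvili–Seregin–Šverák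
  2009, §6, paragraph before Prop. 6.1: `M_k = |u(x_k, t_k)| ≥ N_k/γ_k`, here `γ_k = 2`);
* `W` is a genuine core, not a constant: its oscillation on the closed unit ball is `≥ 1/4`;
* the local Reynolds number is at least `K`: `K ν ≤ L V`, i.e. the core length `L` is at least
  `K` viscous lengths `ν / V` (the KNSS rescaling (6.2), `v(y, s) = M⁻¹ u(x_k + y/M, t_k + s/M²)`,
  uses the viscous length, `L V / ν = 1`);
* the recentred, rotated and rescaled slice `y ↦ V⁻¹ Q⁻¹ u(t, x₀ + L Q y)` is `K⁻¹`-close to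
  `W` in `C⁰` on the closed ball `‖y‖ ≤ K` of `K` core radii.

This is the `C⁰`-velocity topology (velocity strong, vorticity weak) in which inviscid damping /
axisymmetrisation statements are phrased. The two profile classes of the route are the
axisymmetric fields `IsAxisymmetric` (file `AxisymmetricEuler`) and the **columnar** fields
`IsColumnar W : ∀ y τ, W (y + τ • e_z) = W y` (velocity independent of `x₃`: the
two-and-a-half-dimensional flows, "3D flows depending on two space variables", of
Majda–Bertozzi, §2.3.1, Prop. 2.7), defined here.

## Main definitions

* `Literature.Analysis.FluidPDE.IsColumnar W`: `W (y + τ e_z) = W y` for all `y : ℝ³`, `τ : ℝ`.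
* `Literature.Analysis.FluidPDE.TypeIICoreWitness C ν K u t`: the level-`K` witness predicate
  above.

## Main statements (all proved)

* `isColumnar_iff` (columnar ⇔ `W y` depends only on `(y 0, y 1)`), `isColumnar_const`,
  `isColumnar_of_horizontal`, `IsColumnar.comp`, `IsColumnar.comp₂`, `IsColumnar.rescale`.
* `TypeIICoreWitness.mono` (monotone in the class), `TypeIICoreWitness.anti` (antitone in the
  level: for `0 ≤ ν` and `0 < K ≤ K'` a level-`K'` witness is a level-`K` witness),
  `TypeIICoreWitness.anti_viscosity`, `typeIICoreWitness_or_iff` (a witness of class `C ∨ C'`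
  is a witness of class `C` or one of class `C'`), `typeIICoreWitness_congr` (only the slice
  `u t` matters), and the assembly step `TypeIICoreWitness.frequently_or`: if witnesses of
  class `C ∨ C'` occur at every level `K > 0` frequently as `t ↑ T`, then so do witnesses of
  class `C`, or witnesses of class `C'`.
* `typeIICoreWitness_isAxisymmetric_or_isColumnar_iff`: the unfolding, for `E = ℝ³` and the class
  `IsAxisymmetric ∨ IsColumnar`, to the form inlined in the route's items (`Iff.rfl`).

## Mathlib search

No blow-up profile / rescaled-closeness vocabulary in Mathlib (searched `Columnar`, `TypeII`,
`VertInvariant`, `blowup`: nothing relevant); used: `LinearIsometryEquiv` (`E ≃ₗᵢ[ℝ] E`),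
`dist`, `EuclideanSpace.single` (through `eZ`), `inv_anti₀`. In the tree: `IsAxisymmetric`,
`eZ`, `rotZ` (`AxisymmetricEuler`); `IsTypeIBlowup` (`SuitableWeak`); the KNSS near-maximum
selection with `γ = 2` (`KNSSTypeIIZoomIn`, `exists_near_max`). The predicate
`IsVertInvariant f := ∀ x z, f (x + z • eZ) = f x` of `KNSSRegularityPlanarOfSpace` has the same
body as `IsColumnar` (for normed-group-valued `f`); it sits inside the KNSS Theorem 5.2 proof
chain (that file imports `PlanarLiftWeak`, `KNSSLiouvillePlanar`, `KNSSRegularityGluing`) and is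
deliberately not imported, so that this vocabulary file adds nothing beyond `AxisymmetricEuler`
to the import cone of its users; in any file importing both, `IsColumnar f ↔ IsVertInvariant f`
holds by `Iff.rfl`.

## Design notes

* `TypeIICoreWitness` is stated for a general real normed space `E` (as `IsTypeIBlowup` is); the
  class `C : (E → E) → Prop` is a parameter, so that monotonicity in the class and the
  splitting of a disjunctive class are lemmas, and the route's three items are the instances
  `C = (IsAxisymmetric · ∨ IsColumnar ·)`, `C = IsAxisymmetric`, `C = IsColumnar`.
* Only the slice `u t` enters (`typeIICoreWitness_congr`); the arguments `(u, t)` rather than a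
  single field `E → E` follow the requesting route, whose items quantify `∃ t ∈ (t₀, T)` first.
* Intended regime `0 < ν`, `0 < K` (then `anti` nests the levels). Outside it the clauses are
  honest but uninteresting: for `K < 0` the closeness clause is void and for `ν ≤ 0` the
  Reynolds clause `K ν ≤ L V` is automatic.
* `IsColumnar` takes values in an arbitrary `Sort*` (vector fields, pressures, predicates), like
  `IsAxisymmetricScalar`.
* No named facts are introduced: everything here is a definition or a proved lemma.

## References

* G. Koch, N. Nadirashvili, G. Seregin, V. Šverák, *Liouville theorems for the Navier–Stokes
  equations and applications*, Acta Math. 203 (2009) = arXiv:0709.3599, §6: the paragraph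
  before Prop. 6.1 with the rescaling (6.2) (arXiv p. 11). [KochNadirashviliSereginSverak2009]
* A. J. Majda, A. L. Bertozzi, *Vorticity and Incompressible Flow* (CUP 2002), §2.3.1,
  Prop. 2.7 ("3D flows depending on two space variables"). [MajdaBertozziCUP2002]
-/

noncomputable section

namespace Literature.Analysis.FluidPDE

/-- Local notation for physical space `ℝ³ = EuclideanSpace ℝ (Fin 3)`. -/
local notation "ℝ³" => EuclideanSpace ℝ (Fin 3)

/-! ### Columnar (vertically invariant) profiles -/

section Columnar

variable {α β γ : Sort*}

/-- A field `W` on `ℝ³` is **columnar** if it is invariant under all translations along the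
axis direction `e_z`: `W (y + τ e_z) = W y` for all `y ∈ ℝ³`, `τ ∈ ℝ`; equivalently `W y` depends
only on the horizontal coordinates `(y₀, y₁)` (`isColumnar_iff`). For a velocity field these are
the "3D flows depending on two space variables" (two-and-a-half-dimensional flows) of
Majda–Bertozzi, §2.3.1, Prop. 2.7 — the companion symmetry class of `IsAxisymmetric`. Same body
as `IsVertInvariant` of `KNSSRegularityPlanarOfSpace` (not imported; see the module docstring). [cite: MajdaBertozziCUP2002, §2.3.1 Prop 2.7] -/
def IsColumnar (W : ℝ³ → α) : Prop :=
  ∀ (y : ℝ³) (τ : ℝ), W (y + τ • eZ) = W y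

/-- Horizontal coordinates are unchanged by a vertical translation: `(y + τ e_z)₀ = y₀`. [folklore] -/
theorem add_smul_eZ_apply_zero (y : ℝ³) (τ : ℝ) : (y + τ • eZ) 0 = y 0 := by
  simp [eZ]

/-- Horizontal coordinates are unchanged by a vertical translation: `(y + τ e_z)₁ = y₁`. [folklore] -/
theorem add_smul_eZ_apply_one (y : ℝ³) (τ : ℝ) : (y + τ • eZ) 1 = y 1 := by
  simp [eZ]

/-- The vertical coordinate of a vertical translate: `(y + τ e_z)₂ = y₂ + τ`. [folklore] -/
theorem add_smul_eZ_apply_two (y : ℝ³) (τ : ℝ) : (y + τ • eZ) 2 = y 2 + τ := by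
  simp [eZ]

/-- Two points with the same horizontal coordinates differ by a vertical translation:
`y' = y + (y'₂ − y₂) e_z`. [folklore] -/
theorem eq_add_smul_eZ_of_apply_eq {y y' : ℝ³} (h0 : y' 0 = y 0) (h1 : y' 1 = y 1) :
    y' = y + (y' 2 - y 2) • eZ := by
  ext i
  fin_cases i <;> simp [eZ, h0, h1]

/-- A field on `ℝ³` is columnar iff its value depends only on the horizontal coordinates
`(y₀, y₁)` (Majda–Bertozzi, §2.3.1: "does not depend on the `x₃` variable"). [cite: MajdaBertozziCUP2002, §2.3.1 Prop 2.7] -/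
theorem isColumnar_iff {W : ℝ³ → α} :
    IsColumnar W ↔ ∀ y y' : ℝ³, y' 0 = y 0 → y' 1 = y 1 → W y' = W y := by
  constructor
  · intro h y y' h0 h1
    rw [eq_add_smul_eZ_of_apply_eq h0 h1]
    exact h y _
  · intro h y τ
    exact h y _ (add_smul_eZ_apply_zero y τ) (add_smul_eZ_apply_one y τ)

/-- Constant fields are columnar. [folklore] -/
theorem isColumnar_const (a : α) : IsColumnar (fun _ : ℝ³ => a) :=
  fun _ _ => rfl

/-- A field built from the horizontal coordinates only is columnar. [folklore] -/
theorem isColumnar_of_horizontal (f : ℝ → ℝ → α) : IsColumnar (fun y : ℝ³ => f (y 0) (y 1)) := by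
  intro y τ
  simp only [add_smul_eZ_apply_zero, add_smul_eZ_apply_one]

/-- Post-composition preserves columnarity (components, norms, …). [folklore] -/
theorem IsColumnar.comp {W : ℝ³ → α} (hW : IsColumnar W) (g : α → β) :
    IsColumnar (fun y => g (W y)) :=
  fun y τ => congrArg g (hW y τ)

/-- Pointwise binary operations preserve columnarity (sums, differences, scalar multiples of
columnar fields). [folklore] -/
theorem IsColumnar.comp₂ {W : ℝ³ → α} {W' : ℝ³ → β} (hW : IsColumnar W) (hW' : IsColumnar W')
    (g : α → β → γ) : IsColumnar (fun y => g (W y) (W' y)) :=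
  fun y τ => congrArg₂ g (hW y τ) (hW' y τ)

/-- Columnarity is invariant under the recentring and rescaling `y ↦ x₀ + L y` of the blow-up
zoom. [folklore] -/
theorem IsColumnar.rescale {W : ℝ³ → α} (hW : IsColumnar W) (x₀ : ℝ³) (L : ℝ) :
    IsColumnar (fun y => W (x₀ + L • y)) := by
  intro y τ
  have h : x₀ + L • (y + τ • eZ) = (x₀ + L • y) + (L * τ) • eZ := by
    rw [smul_add, smul_smul, add_assoc]
  simp only [h]
  exact hW _ _

end Columnar

/-! ### Level-`K` core witnesses -/

section Witness

variable {E : Type*} [NormedAddCommGroup E] [NormedSpace ℝ E]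

/-- **Level-`K` core witness of class `C`** for the slice `u t` of a velocity field
`u : ℝ → E → E` at viscosity `ν`: there are a centre `x₀`, a core length `L > 0`, a speed bound
`V > 0`, a linear isometry `Q` of `E` and a profile `W` of class `C` such that (i) `‖u t x‖ ≤ V`
for all `x`, (ii) `V ≤ 2 ‖u t x₁‖` for some `x₁` with `dist x₁ x₀ ≤ L` (near-maximum, factor `2`,
as in the Koch–Nadirashvili–Seregin–Šverák zoom, §6 before Prop. 6.1), (iii) `W` has oscillation
`≥ 1/4` on the closed unit ball, (iv) the local Reynolds number is at least `K`, `K ν ≤ L V`, and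
(v) the recentred, rotated, rescaled slice is `K⁻¹`-close to `W` in `C⁰` on `K` core radii:
`‖V⁻¹ • Q⁻¹ (u t (x₀ + L • Q y)) − W y‖ ≤ K⁻¹` for `‖y‖ ≤ K`. Route vocabulary (Type II =
diverging local Reynolds number at the core scale); intended for `0 < ν`, `0 < K`. [folklore] -/
def TypeIICoreWitness (C : (E → E) → Prop) (ν K : ℝ) (u : ℝ → E → E) (t : ℝ) : Prop :=
  ∃ (x₀ : E) (L V : ℝ) (Q : E ≃ₗᵢ[ℝ] E) (W : E → E), 0 < L ∧ 0 < V ∧ C W ∧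
    (∀ x, ‖u t x‖ ≤ V) ∧ (∃ x₁, dist x₁ x₀ ≤ L ∧ V ≤ 2 * ‖u t x₁‖) ∧
    (∃ y y' : E, ‖y‖ ≤ 1 ∧ ‖y'‖ ≤ 1 ∧ (4 : ℝ)⁻¹ ≤ ‖W y - W y'‖) ∧ K * ν ≤ L * V ∧
    ∀ y : E, ‖y‖ ≤ K → ‖V⁻¹ • Q.symm (u t (x₀ + L • Q y)) - W y‖ ≤ K⁻¹

variable {C C' : (E → E) → Prop} {ν ν' K K' : ℝ} {u u' : ℝ → E → E} {t t' T : ℝ}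

/-- Unfolding of `TypeIICoreWitness`. [folklore] -/
theorem typeIICoreWitness_iff :
    TypeIICoreWitness C ν K u t ↔
      ∃ (x₀ : E) (L V : ℝ) (Q : E ≃ₗᵢ[ℝ] E) (W : E → E), 0 < L ∧ 0 < V ∧ C W ∧
        (∀ x, ‖u t x‖ ≤ V) ∧ (∃ x₁, dist x₁ x₀ ≤ L ∧ V ≤ 2 * ‖u t x₁‖) ∧
        (∃ y y' : E, ‖y‖ ≤ 1 ∧ ‖y'‖ ≤ 1 ∧ (4 : ℝ)⁻¹ ≤ ‖W y - W y'‖) ∧ K * ν ≤ L * V ∧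
        ∀ y : E, ‖y‖ ≤ K → ‖V⁻¹ • Q.symm (u t (x₀ + L • Q y)) - W y‖ ≤ K⁻¹ :=
  Iff.rfl

/-- **Monotonicity in the class**: a witness of class `C` is a witness of any larger class `C'`.
[folklore] -/
theorem TypeIICoreWitness.mono (h : TypeIICoreWitness C ν K u t) (hC : ∀ W, C W → C' W) :
    TypeIICoreWitness C' ν K u t := by
  obtain ⟨x₀, L, V, Q, W, hL, hV, hW, hrest⟩ := h
  exact ⟨x₀, L, V, Q, W, hL, hV, hC W hW, hrest⟩

/-- **Antitonicity in the level**: for `0 ≤ ν` and `0 < K ≤ K'`, a level-`K'` witness is a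
level-`K` witness (same data: `K ν ≤ K' ν ≤ L V`, the ball `‖y‖ ≤ K` lies in `‖y‖ ≤ K'`, and
`K'⁻¹ ≤ K⁻¹`). [folklore] -/
theorem TypeIICoreWitness.anti (h : TypeIICoreWitness C ν K' u t) (hν : 0 ≤ ν) (hK : 0 < K)
    (hKK' : K ≤ K') : TypeIICoreWitness C ν K u t := by
  obtain ⟨x₀, L, V, Q, W, hL, hV, hW, hb, hmax, hosc, hRe, hclose⟩ := h
  refine ⟨x₀, L, V, Q, W, hL, hV, hW, hb, hmax, hosc, ?_, fun y hy => ?_⟩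
  · exact (mul_le_mul_of_nonneg_right hKK' hν).trans hRe
  · exact (hclose y (hy.trans hKK')).trans (inv_anti₀ hK hKK')

/-- **Antitonicity in the viscosity**: for `0 ≤ K`, a witness at viscosity `ν` is a witness at
any smaller viscosity `ν' ≤ ν` (only the Reynolds clause involves `ν`). [folklore] -/
theorem TypeIICoreWitness.anti_viscosity (h : TypeIICoreWitness C ν K u t) (hK : 0 ≤ K)
    (hν : ν' ≤ ν) : TypeIICoreWitness C ν' K u t := by
  obtain ⟨x₀, L, V, Q, W, hL, hV, hW, hb, hmax, hosc, hRe, hclose⟩ := h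
  exact ⟨x₀, L, V, Q, W, hL, hV, hW, hb, hmax, hosc, (mul_le_mul_of_nonneg_left hν hK).trans hRe,
    hclose⟩

/-- **Splitting a disjunctive class**: a witness of class `C ∨ C'` is a witness of class `C` or
a witness of class `C'`, and conversely. [folklore] -/
theorem typeIICoreWitness_or_iff :
    TypeIICoreWitness (fun W => C W ∨ C' W) ν K u t ↔
      TypeIICoreWitness C ν K u t ∨ TypeIICoreWitness C' ν K u t := by
  constructor
  · rintro ⟨x₀, L, V, Q, W, hL, hV, hW | hW, hrest⟩
    · exact Or.inl ⟨x₀, L, V, Q, W, hL, hV, hW, hrest⟩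
    · exact Or.inr ⟨x₀, L, V, Q, W, hL, hV, hW, hrest⟩
  · rintro (h | h)
    · exact h.mono fun W hW => Or.inl hW
    · exact h.mono fun W hW => Or.inr hW

/-- A class with no members has no witnesses. [folklore] -/
theorem not_typeIICoreWitness_of_forall_not (hC : ∀ W, ¬ C W) :
    ¬ TypeIICoreWitness C ν K u t :=
  fun ⟨_, _, _, _, W, _, _, hW, _⟩ => hC W hW

/-- Only the slice `u t` enters the witness predicate. [folklore] -/
theorem typeIICoreWitness_congr (h : u t = u' t') :
    TypeIICoreWitness C ν K u t ↔ TypeIICoreWitness C ν K u' t' := by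
  unfold TypeIICoreWitness
  rw [h]

/-- A witness at a level `K` with `0 < ν` has local Reynolds number `L V / ν ≥ K`; in
particular the class `C` is inhabited and the slice is not identically small:
`V / 2 ≤ ‖u t x₁‖` somewhere. This lemma records the first consequence, `K ≤ L V / ν`. [folklore] -/
theorem TypeIICoreWitness.exists_level_le_reynolds (h : TypeIICoreWitness C ν K u t) (hν : 0 < ν) :
    ∃ (x₀ : E) (L V : ℝ), 0 < L ∧ 0 < V ∧ (∃ x₁, dist x₁ x₀ ≤ L ∧ V ≤ 2 * ‖u t x₁‖) ∧
      K ≤ L * V / ν := by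
  obtain ⟨x₀, L, V, Q, W, hL, hV, hW, hb, hmax, hosc, hRe, hclose⟩ := h
  exact ⟨x₀, L, V, hL, hV, hmax, (le_div_iff₀ hν).2 hRe⟩

/-- **The assembly step of the relaxation dichotomy.** If, for every level `K > 0`, witnesses of
the disjunctive class `C ∨ C'` occur frequently as `t ↑ T` (for every `t₀ < T` at some
`t ∈ (t₀, T)`), then either witnesses of class `C` occur at every level frequently, or witnesses
of class `C'` do (`0 ≤ ν`). Proof: otherwise class `C` fails beyond some `t₁` at some level `K₁`
and class `C'` beyond `t₂` at level `K₂`; a `C ∨ C'` witness at level `max K₁ K₂` after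
`max t₁ t₂` is, by `typeIICoreWitness_or_iff` and antitonicity in the level, a `C` witness at
level `K₁` or a `C'` witness at level `K₂`, a contradiction. [folklore] -/
theorem TypeIICoreWitness.frequently_or (hν : 0 ≤ ν)
    (h : ∀ K : ℝ, 0 < K → ∀ t₀ < T, ∃ t, t₀ < t ∧ t < T ∧
      TypeIICoreWitness (fun W => C W ∨ C' W) ν K u t) :
    (∀ K : ℝ, 0 < K → ∀ t₀ < T, ∃ t, t₀ < t ∧ t < T ∧ TypeIICoreWitness C ν K u t) ∨
      (∀ K : ℝ, 0 < K → ∀ t₀ < T, ∃ t, t₀ < t ∧ t < T ∧ TypeIICoreWitness C' ν K u t) := by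
  by_contra hcon
  push Not at hcon
  obtain ⟨⟨K₁, hK₁, t₁, ht₁, h₁⟩, ⟨K₂, hK₂, t₂, ht₂, h₂⟩⟩ := hcon
  obtain ⟨t, ht₀, htT, hw⟩ :=
    h (max K₁ K₂) (lt_max_of_lt_left hK₁) (max t₁ t₂) (max_lt ht₁ ht₂)
  rcases typeIICoreWitness_or_iff.1 hw with hw | hw
  · exact h₁ t ((le_max_left _ _).trans_lt ht₀) htT (hw.anti hν hK₁ (le_max_left _ _))
  · exact h₂ t ((le_max_right _ _).trans_lt ht₀) htT (hw.anti hν hK₂ (le_max_right _ _))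

end Witness

/-! ### The instance of route `TypeIIInviscidRelaxation` -/

section Route

/-- Unfolding of the witness predicate for `E = ℝ³` and the class "axisymmetric or columnar"
to the form inlined in the items of route `TypeIIInviscidRelaxation` (`TypeIICoreRelaxation`;
the items `MonopoleCoreExclusion` / `ColumnarCoreExclusion` are the instances
`C = IsAxisymmetric` / `C = IsColumnar`, which unfold in the same way). Definitional
(`Iff.rfl`). [folklore] -/
theorem typeIICoreWitness_isAxisymmetric_or_isColumnar_iff (ν K : ℝ) (u : ℝ → ℝ³ → ℝ³) (t : ℝ) :
    TypeIICoreWitness (fun W => IsAxisymmetric W ∨ IsColumnar W) ν K u t ↔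
      ∃ (x₀ : ℝ³) (L V : ℝ) (Q : ℝ³ ≃ₗᵢ[ℝ] ℝ³) (W : ℝ³ → ℝ³), 0 < L ∧ 0 < V ∧
        (IsAxisymmetric W ∨ ∀ (y : ℝ³) (τ : ℝ), W (y + τ • eZ) = W y) ∧
        (∀ x, ‖u t x‖ ≤ V) ∧ (∃ x₁, dist x₁ x₀ ≤ L ∧ V ≤ 2 * ‖u t x₁‖) ∧
        (∃ y y' : ℝ³, ‖y‖ ≤ 1 ∧ ‖y'‖ ≤ 1 ∧ (4 : ℝ)⁻¹ ≤ ‖W y - W y'‖) ∧ K * ν ≤ L * V ∧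
        ∀ y : ℝ³, ‖y‖ ≤ K → ‖V⁻¹ • Q.symm (u t (x₀ + L • Q y)) - W y‖ ≤ K⁻¹ :=
  Iff.rfl

end Route

end Literature.Analysis.FluidPDE
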